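import Literature.Probability.Percolation.HierarchicalMaxCluster
import HarnessLib

/-!
# Hierarchical long-range percolation: ingredients of the renormalisation of `M_B` (Hutchcroft 2022, Lemma 2.6)

Topic `Literature/Probability/Percolation`. Theorem-only companion of `HierarchicalMaxCluster.lean`
assembling the ingredients of the proof of Hutchcroft 2022, Lemma 2.6 ("Renormalization of the
maximum cluster size") on the labelled space `hierLaw` (for the named fact
`Hutchcroft2022_twoPoint_volumeTail`):

* `determinedBy_preimage_etaCfg` — events about `η_A` are determined by the coordinates of `A`'s
  copies ("`𝓕` is independent of the configuration `ω_{σ(B)}`"), and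
  `blockEdges_succ_disjoint_aboveFree` — the pairs of `σ(B)` are not among them;
* `mk_mem_blockEdges_of_children`, `coe_hierParam_one_of_blockEdges`,
  **`hierLaw_real_forall_cross_closed`** — "the conditional probability given `𝓕` that `D_i` is
  connected to `D_j` by an edge of `ω_{σ(B)}` is equal to `1 - exp[-cβL^{-(d+α)(n+1)}|D_i||D_j|]`"
  (here: all cross copies closed with probability `exp(-cβL^{-(d+α)(n+1)}|D₁||D₂|)`);
* `sum_card_le_clusterMaxIn_union` — linked disjoint traces lie in one cluster of `η ∪ ω'`
  (`|K^max_{σ(B)}| ≥ Σ |D_i|`);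
* `measureReal_count_ge_le` — Markov's inequality for the number of occurring events ((2.10)).

## References

* [Hutchcroft2022] T. Hutchcroft, J. Math. Phys. 63 (2022), arXiv:2202.07634, proof of Lemma 2.6
  (pp. 9–10), (2.10).
-/

noncomputable section

namespace Literature.Probability.Percolation

open Finset Literature.Probability.LatticeModels

variable {d : ℕ}

/-! ### Finite dependence and the cross copies -/

section Lemma26Ingredients

open MeasureTheory

variable {L : ℕ} (hL : 2 ≤ L) (hd : 1 ≤ d) {o : ℕ → Site d} (ho : IsHierOffset L o)

omit hL hd ho in
/-- `η_A` only depends on the coordinates `(e,0)` and `(e,1)`, `e ∈ A`. [folklore] -/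
theorem etaCfg_inter_support (A : Set (Sym2 (Site d))) (ξ : Set (Sym2 (Site d) × Fin 2)) :
    etaCfg A (ξ ∩ {k | k.2 = 0 ∨ k.1 ∈ A}) = etaCfg A ξ := by
  ext e; simp [etaCfg]

omit hL hd ho in
/-- **Events about `η_A` are determined by the coordinates `(e,0)`, `(e,1)` with `e ∈ A`** (so, for
`η_B`, by the complement of the hierarchical copies of the pairs of `σ(B)`: "`𝓕` is independent
of the configuration `ω_{σ(B)}`"). [cite: Hutchcroft2022, proof of Lemma 2.6 (p. 10)] -/
theorem determinedBy_preimage_etaCfg (A : Set (Sym2 (Site d))) (E : Set (BondConfig (Site d))) :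
    DeterminedBy ((etaCfg A) ⁻¹' E) {k : Sym2 (Site d) × Fin 2 | k.2 = 0 ∨ k.1 ∈ A} := by
  rw [determinedBy_iff]
  intro ξ ξ' h
  simp only [Set.mem_preimage]
  rw [← etaCfg_inter_support A ξ, ← etaCfg_inter_support A ξ', h]

include hL hd ho in
/-- **The pairs of `σ(B)` are not selected by `A_B`** (their block `σ(B)` is a strict ancestor of the
child `B`): `blockEdges (n+1) x ∩ aboveFree B = ∅`. [cite: Hutchcroft2022, §2.1 (p. 7)] -/
theorem blockEdges_succ_disjoint_aboveFree {n : ℕ} {x : Site d} {B : Finset (Site d)}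
    (hB : B ∈ children L o n x) {e : Sym2 (Site d)} (he : e ∈ blockEdges L o (n + 1) x) :
    e ∉ aboveFree L o B := by
  rw [mem_aboveFree_child_iff hL hd ho hB, not_not, he.2.1]

include hL ho in
/-- **Cross pairs between distinct children are pairs of the parent**: for `a ∈ B₁`, `b ∈ B₂`,
distinct children of `B_{n+1}(x)`, `{a,b} ∈ blockEdges (n+1) x`. [cite: Hutchcroft2022, proof of Lemma 2.6 (p. 10)] -/
theorem mk_mem_blockEdges_of_children {n : ℕ} {x a b : Site d} {B₁ B₂ : Finset (Site d)}
    (hB₁ : B₁ ∈ children L o n x) (hB₂ : B₂ ∈ children L o n x) (hne : B₁ ≠ B₂) (ha : a ∈ B₁)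
    (hb : b ∈ B₂) : s(a, b) ∈ blockEdges L o (n + 1) x := by
  have hL1 : 1 ≤ L := le_trans (by norm_num) hL
  obtain ⟨y₁, hy₁, rfl⟩ := (mem_children_iff o).1 hB₁
  obtain ⟨y₂, hy₂, rfl⟩ := (mem_children_iff o).1 hB₂
  have ha' : a ∈ block L o (n + 1) x := subset_of_mem_children hL1 o ho hB₁ ha
  have hb' : b ∈ block L o (n + 1) x := subset_of_mem_children hL1 o ho hB₂ hb
  have hblk : block L o n a ≠ block L o n b := by
    rw [(block_eq_iff_mem hL1 o).2 ha, (block_eq_iff_mem hL1 o).2 hb]; exact hne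
  obtain ⟨hlev, hcommon⟩ := hLevel_eq_succ_of_children hL ho ha' hb' hblk
  have hab : a ≠ b := fun h => hblk (h ▸ rfl)
  have hprop : IsProperEdge L o s(a, b) := ⟨hab, Or.inl hcommon⟩
  refine ⟨hprop, ?_, ?_⟩
  · rw [edgeBlock_mk hL ho hprop, hlev]
    exact (block_eq_iff_mem hL1 o).2 ha'
  · rw [(edgeLevel_mk hL ho hprop).1, hlev]

include hL ho in
/-- **The hierarchical copy of a pair of `σ(B)` is open with probability `1 - exp(-cβL^{-(d+α)(n+1)})`.**
[cite: Hutchcroft2022, proof of Lemma 2.6 (p. 10, "1 - exp[-cβL^{-(d+α)(n+1)}|D_i||D_j|]")] -/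
theorem coe_hierParam_one_of_blockEdges {J : Sym2 (Site d) → ℝ} {c α β : ℝ} (hc : 0 ≤ c) (hβ : 0 ≤ β)
    {n : ℕ} {x : Site d} {e : Sym2 (Site d)} (he : e ∈ blockEdges L o (n + 1) x) :
    (hierParam J L o c α β (e, 1) : ℝ) = 1 - Real.exp (-(β * (c * ((L : ℝ) ^ (n + 1)) ^ (-((d : ℝ) + α))))) := by
  have hL1 : 1 ≤ L := le_trans (by norm_num) hL
  obtain ⟨hprop, -, hlev⟩ := he
  induction e using Sym2.ind with
  | h a b =>
    obtain ⟨hab, hcommon⟩ := hprop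
    have hc' : HasCommonBlock L o a b := hcommon.elim id fun h' => h'.symm o hL1
    have hH : hierKernel L o c α s(a, b) = c * ((L : ℝ) ^ (n + 1)) ^ (-((d : ℝ) + α)) := by
      rw [hierKernel_mk hL1 ho, if_pos ⟨hab, hc'⟩, ← (edgeLevel_mk hL ho ⟨hab, hcommon⟩).1, hlev]
    have hnn : 0 ≤ β * hierKernel L o c α s(a, b) := mul_nonneg hβ (hierKernel_nonneg hc α _)
    simp only [hierParam, Fin.isValue, one_ne_zero, if_false]
    rw [coe_kernelEdgeProb hnn, hH]

include hL ho in
/-- **All hierarchical copies of the pairs between two sets are closed with probability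
`exp(-β Σ H)`**: for finite `D₁ ⊆ B₁`, `D₂ ⊆ B₂` in distinct children of `σ(B)`,
`P_{β,σ}(no (a,b) ∈ D₁ × D₂ open in ω_{σ(B)}) = exp(-cβL^{-(d+α)(n+1)} |D₁| |D₂|)`.
[cite: Hutchcroft2022, proof of Lemma 2.6 (p. 10)] -/
theorem hierLaw_real_forall_cross_closed {J : Sym2 (Site d) → ℝ} {c α β : ℝ} (hc : 0 ≤ c) (hβ : 0 ≤ β)
    {n : ℕ} {x : Site d} {B₁ B₂ : Finset (Site d)} (hB₁ : B₁ ∈ children L o n x)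
    (hB₂ : B₂ ∈ children L o n x) (hne : B₁ ≠ B₂) {D₁ D₂ : Finset (Site d)} (hD₁ : D₁ ⊆ B₁) (hD₂ : D₂ ⊆ B₂) :
    (hierLaw J L o c α β).real {ξ | ∀ a ∈ D₁, ∀ b ∈ D₂, (s(a, b), (1 : Fin 2)) ∉ ξ} =
      Real.exp (-(β * (c * ((L : ℝ) ^ (n + 1)) ^ (-((d : ℝ) + α))) * (D₁.card * D₂.card))) := by
  classical
  have hL1 : 1 ≤ L := le_trans (by norm_num) hL
  -- the coordinates `(s(a,b), 1)`, `(a, b) ∈ D₁ × D₂`, are pairwise distinct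
  set F : Finset (Sym2 (Site d) × Fin 2) := (D₁ ×ˢ D₂).image fun ab => (s(ab.1, ab.2), (1 : Fin 2)) with hF
  have hinj : Set.InjOn (fun ab : Site d × Site d => (s(ab.1, ab.2), (1 : Fin 2))) ↑(D₁ ×ˢ D₂) := by
    rintro ⟨a, b⟩ hab ⟨a', b'⟩ hab' h
    simp only [Finset.coe_product, Set.mem_prod, Finset.mem_coe] at hab hab'
    simp only [Prod.mk.injEq, and_true] at h
    rcases Sym2.eq_iff.1 h with ⟨rfl, rfl⟩ | ⟨rfl, rfl⟩
    · rfl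
    · -- `a ∈ D₁ ∩ D₂`-type clash with disjoint children
      exfalso
      obtain ⟨y₁, -, rfl⟩ := (mem_children_iff o).1 hB₁
      obtain ⟨y₂, -, rfl⟩ := (mem_children_iff o).1 hB₂
      rcases block_eq_or_disjoint hL1 o n y₁ y₂ with h | h
      · exact hne h
      · exact Finset.disjoint_left.1 h (hD₁ hab.1) (hD₂ hab'.2)
  have hset : {ξ : Set (Sym2 (Site d) × Fin 2) | ∀ a ∈ D₁, ∀ b ∈ D₂, (s(a, b), (1 : Fin 2)) ∉ ξ} =
      {ξ | ∀ k ∈ F, k ∉ ξ} := by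
    ext ξ
    simp only [Set.mem_setOf_eq, hF, Finset.mem_image, Finset.mem_product, Prod.exists,
      forall_exists_index, and_imp]
    constructor
    · rintro h k a b ha hb rfl; exact h a ha b hb
    · intro h a ha b hb; exact h _ a b ha hb rfl
  rw [hset, hierLaw, prodBernoulli_real_forall_notMem, hF, Finset.prod_image hinj]
  -- each factor is `exp(-β H)` with the same `H`
  have hfac : ∀ ab ∈ D₁ ×ˢ D₂, (1 - (hierParam J L o c α β (s(ab.1, ab.2), (1 : Fin 2)) : ℝ)) =
      Real.exp (-(β * (c * ((L : ℝ) ^ (n + 1)) ^ (-((d : ℝ) + α))))) := by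
    rintro ⟨a, b⟩ hab
    simp only [Finset.mem_product] at hab
    rw [coe_hierParam_one_of_blockEdges hL ho hc hβ
      (mk_mem_blockEdges_of_children hL ho hB₁ hB₂ hne (hD₁ hab.1) (hD₂ hab.2))]
    ring
  rw [Finset.prod_congr rfl hfac, Finset.prod_const, Finset.card_product, ← Real.exp_nat_mul]
  congr 1
  push_cast
  ring

end Lemma26Ingredients

section Lemma26More

open MeasureTheory

variable {V : Type*}

/-- **Linked traces merge** (deterministic core of Lemma 2.6: "the conditional probability … that
`D_i` is connected to `D_j` by an edge of `ω_{σ(B)}` for every `i` and `j` …, so that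
`|K^max_{σ(B)}| ≥ …`): if pairwise disjoint finite sets `D_i ⊆ Λ`, each inside one cluster of `η`,
are pairwise joined by an edge of `ω'`, then in `η ∪ ω'` they lie in one cluster, whose trace on
`Λ` has at least `Σ |D_i|` vertices. [cite: Hutchcroft2022, proof of Lemma 2.6 (p. 10)] -/
theorem sum_card_le_clusterMaxIn_union [DecidableEq V] {κ : Type*} (s : Finset κ) (D : κ → Finset V)
    (Λ : Finset V) (η ω' : BondConfig V) (hΛ : ∀ i ∈ s, D i ⊆ Λ)
    (hconn : ∀ i ∈ s, ∃ v, ∀ z ∈ D i, (openGraph η).Reachable v z)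
    (hdisj : (↑s : Set κ).PairwiseDisjoint D)
    (hlink : ∀ i ∈ s, ∀ j ∈ s, i ≠ j → ∃ a ∈ D i, ∃ b ∈ D j, a ≠ b ∧ s(a, b) ∈ ω') :
    ∑ i ∈ s, (D i).card ≤ clusterMaxIn Λ (η ∪ ω') := by
  classical
  rcases s.eq_empty_or_nonempty with rfl | ⟨i₀, hi₀⟩
  · simp
  obtain ⟨v₀, hv₀⟩ := hconn i₀ hi₀
  have hmono : openGraph η ≤ openGraph (η ∪ ω') := openGraph_mono Set.subset_union_left
  -- every vertex of every `D j` is reachable from `v₀` in `η ∪ ω'`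
  have hreach : ∀ j ∈ s, ∀ z ∈ D j, (openGraph (η ∪ ω')).Reachable v₀ z := by
    intro j hj z hz
    by_cases hij : i₀ = j
    · subst hij; exact (hv₀ z hz).mono hmono
    · obtain ⟨a, ha, b, hb, hab, he⟩ := hlink i₀ hi₀ j hj hij
      obtain ⟨vj, hvj⟩ := hconn j hj
      have h1 : (openGraph (η ∪ ω')).Reachable v₀ a := (hv₀ a ha).mono hmono
      have h2 : (openGraph (η ∪ ω')).Reachable a b :=
        SimpleGraph.Adj.reachable ((openGraph_adj _ a b).2 ⟨Set.mem_union_right _ he, hab⟩)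
      have h3 : (openGraph (η ∪ ω')).Reachable b z := ((hvj b hb).symm.trans (hvj z hz)).mono hmono
      exact (h1.trans h2).trans h3
  calc ∑ i ∈ s, (D i).card = (s.biUnion D).card := (Finset.card_biUnion hdisj).symm
    _ ≤ clusterCapIn Λ (η ∪ ω') v₀ := by
        rw [clusterCapIn_eq]
        refine Finset.card_le_card fun z hz => ?_
        obtain ⟨j, hj, hzj⟩ := Finset.mem_biUnion.1 hz
        exact Finset.mem_filter.2 ⟨hΛ j hj hzj, hreach j hj z hzj⟩
    _ ≤ clusterMaxIn Λ (η ∪ ω') := clusterCapIn_le_clusterMaxIn' Λ _ v₀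

/-- **Markov's inequality for a count of events**: if each of the finitely many events `E_i` has
probability `≤ p`, then at least `t > 0` of them occur with probability `≤ |S| p / t` ("It follows by
Markov's inequality that …", (2.10)). [cite: Hutchcroft2022, proof of Lemma 2.6 (2.10)] -/
theorem measureReal_count_ge_le {Ω : Type*} [MeasurableSpace Ω] (μ : Measure Ω) [IsProbabilityMeasure μ]
    {κ : Type*} (S : Finset κ) (E : κ → Set Ω) [∀ i ω, Decidable (ω ∈ E i)]
    (hE : ∀ i ∈ S, MeasurableSet (E i)) {p t : ℝ} (ht : 0 < t) (hp : ∀ i ∈ S, μ.real (E i) ≤ p) :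
    μ.real {ω | t ≤ ((S.filter fun i => ω ∈ E i).card : ℝ)} ≤ S.card * p / t := by
  classical
  -- the count as a sum of indicators
  set N : Ω → ℝ := fun ω => ∑ i ∈ S, (E i).indicator (fun _ => (1 : ℝ)) ω with hN
  have hNeq : ∀ ω, N ω = ((S.filter fun i => ω ∈ E i).card : ℝ) := by
    intro ω
    simp only [hN, Set.indicator_apply, Finset.sum_boole]
  have hint : Integrable N μ :=
    integrable_finsetSum _ fun i hi => (integrable_const (1 : ℝ)).indicator (hE i hi)
  have hnn : 0 ≤ᵐ[μ] N := Filter.Eventually.of_forall fun ω =>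
    Finset.sum_nonneg fun i _ => Set.indicator_nonneg (fun _ _ => zero_le_one) _
  have hmarkov := mul_meas_ge_le_integral_of_nonneg hnn hint t
  have hintegral : ∫ ω, N ω ∂μ ≤ S.card * p := by
    rw [hN, integral_finsetSum _ fun i hi => (integrable_const (1 : ℝ)).indicator (hE i hi)]
    calc ∑ i ∈ S, ∫ ω, (E i).indicator (fun _ => (1 : ℝ)) ω ∂μ = ∑ i ∈ S, μ.real (E i) :=
          Finset.sum_congr rfl fun i hi => by
            rw [integral_indicator_const _ (hE i hi), smul_eq_mul, mul_one]
      _ ≤ ∑ i ∈ S, p := Finset.sum_le_sum hp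
      _ = S.card * p := by rw [Finset.sum_const, nsmul_eq_mul]
  have hset : {ω | t ≤ ((S.filter fun i => ω ∈ E i).card : ℝ)} = {ω | t ≤ N ω} := by
    ext ω; rw [Set.mem_setOf_eq, Set.mem_setOf_eq, hNeq]
  rw [hset, le_div_iff₀ ht, mul_comm]
  exact hmarkov.trans hintegral

end Lemma26More


end Literature.Probability.Percolation

end
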